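import Summits.PneNP.PneNP.Theorems.PhaseTwinsNoFBPPApproxAboveUniquenessConjectureWeb
import Summits.PneNP.PneNP.Theorems.PhaseTwinsNoFBPPApproxAboveUniquenessCalibrationWeb
import Summits.PneNP.PneNP.Theorems.PhaseTwinsPseudorandomTwinsImplyTarget
import Summits.PneNP.PneNP.Theorems.PhaseTwinsPolyDepthTwinsAbove
import Summits.PneNP.PneNP.Theorems.NoFBPPApproxAboveUniqueness.Negative.FPRASDictionary
import Summits.PneNP.PneNP.Theorems.NoFBPPApproxAboveUniqueness.Negative.FalseOfNPSubsetBPP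
import Literature.Computability.Complexity.ClayProblemProofs
import Literature.Computability.Complexity.SipserGacsLautemann
import Literature.ModelTheory.FiniteModelTheory.CFIUncolouredSeparatorProofs
import Literature.ModelTheory.FiniteModelTheory.CFIUncolouredProofs
import Literature.Barriers.PneNP.MonotoneGap
import Literature.Barriers.PneNP.NaturalProofs

/-!
# STRATEGY CENSUS — kernel-checked companion (crux-strategist, `cstrat-stmt-PneNP-2717`, gen 1)

Crux `stmt-PneNP-2717` = `X := Summit.PneNP.PneNP.Theses.PhaseTwins.NoFBPPApproxAboveUniqueness`
(route PhaseTwins, the ONLY open leaf of its deciding theorem `closes hN hX hA`). The prose census is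
`Cruxes/NoFBPPApproxAboveUniqueness/STRATEGY-CENSUS.md`; this file holds the statements of that census
that can be kernel-checked today, so that the verdict "no strategy short of the summit" is EARNED:

* §D (Decomposition) `crux_iff_summit_and_derand` — **X ⟺ PneNP ∧ (NP ⊆ BPP → NP ⊆ P)**, fact-free:
  the crux is LITERALLY the summit plus a derandomisation-under-collapse conditional; every typed split
  of X is therefore a split of the summit (`summit_of_any_split`), and the one canonical 2-split has the
  summit itself as a piece. The second piece is re-read as `NP ⊆ BPP → BPP ⊆ P` given the standard
  collapse `NP ⊆ P → PH ⊆ P` (`derand_iff_of_collapse`, hypothesis explicit).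
* §S (Strengthen) the typed strengthenings S⁺ and their (proved / landed) arrows to X:
  `crux_of_universalNoFPRAS` (GŠV's universal form), `crux_of_pseudorandomTwinsAbove` (route item #4,
  landed glue), `crux_of_NPNotSubsetPPoly` / `crux_of_OWFExist` / `crux_of_PRGExist` (registered
  conjecture leaves) — each S⁺ is ≥ X ≥ summit and none carries an induction/compactness handle.
* §T (Transfer) the solved sibling of exactly this step inside the route — the DEPTH rung
  `PolyDepthTwinsAbove` (crux #2), proved modulo Sly's gadget theorem
  (`ParityWiredPorts.PolyDepthTwinsAbove_of_slyGadgetReduction`) — and the kernel-checked BREAK POINT of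
  the depth → time transfer: CFI twins, `C^k`-equivalent up to the treewidth of the base
  (`ChenFlumLiu2025_ckEquiv_of_le_treewidth_holds`), are separated in polynomial time
  (`ChenFlumLiu2025_ptime_separation_holds`, Gaussian-elimination-type parity separator, PROVED in the
  tree); plus the catalogued transfer no-gos for the other solved restricted models
  (`MonotoneGap.not_monotoneTransfer_pow`, `NaturalProofs.no_naturalProof_for`; Holmgren–Wein's
  `LowDegreeCounterexamples.not_lowDegreeTransfer` cited by name) and the crux's own one-sided relativisation no-go
  (`Negative.not_relativizes_relCrux`).
* §N (Negation) the only counterexample route: `¬X ⟺ NP ⊆ BPP` (`Negative.not_crux_iff`,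
  `noFBPPApproxAboveUniqueness_false_of_NP_subset_BPP`), and the typed "restricted-family" obstruction
  `NoFPApproxOn 𝒢` with `X ↔ NoFPApproxOn univ-at-(3,5,1)`-type bookkeeping left in prose.

0 sorries. Nothing here is a landing; it is evidence for the census.
-/

set_option linter.dupNamespace false
set_option linter.unusedVariables false

namespace Summit.PneNP.PneNP.Cruxes.NoFBPPApproxAboveUniqueness.StrategyCensus

open Literature.Computability.Complexity Literature.Probability.LatticeModels
open Summit.PneNP.PneNP.Theses.PhaseTwins
open Summit.PneNP.PneNP.Theorems
open Summit.PneNP.PneNP.Theorems.NoFBPPApproxAboveUniqueness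
open _root_.Computability Literature.Computability.MetaComplexity

/-! ## §C Calibration recap (all landed; restated so this file's audit lists them) -/

/-- X ⟺ NP ⊄ BPP (p93858), X ⟺ NP ≠ RP (p96055), X ⟺ PH ≠ BPP and X ⟺ SAT ∉ BPP (p96357), X ⟹ PneNP
(unconditional). [folklore] -/
theorem calibration :
    (NoFBPPApproxAboveUniqueness ↔ ¬ (Nondeterministic.NP ⊆ BPP)) ∧
    (NoFBPPApproxAboveUniqueness ↔ Nondeterministic.NP ≠ RP) ∧
    (NoFBPPApproxAboveUniqueness ↔ PH ≠ BPP) ∧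
    (NoFBPPApproxAboveUniqueness ↔ SAT ∉ BPP) ∧
    (NoFBPPApproxAboveUniqueness → _root_.PneNP) :=
  ⟨noFBPPApproxAboveUniqueness_iff_not_NP_subset_BPP, noFBPPApproxAboveUniqueness_iff_NP_ne_RP,
    noFBPPApproxAboveUniqueness_iff_PH_ne_BPP, noFBPPApproxAboveUniqueness_iff_SAT_not_mem_BPP,
    pneNP_of_noFBPPApproxAboveUniqueness⟩

/-! ## §D Decomposition -/

/-- The summit in the prelude's classes: `PneNP ↔ NP ⊄ P` (model bridges `P_bool_eq_holds`,
`NP_bool_eq_holds`, both proved). [folklore] -/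
theorem pneNP_iff_not_NP_subset_P : _root_.PneNP ↔ ¬ (Nondeterministic.NP ⊆ Classes.P) := by
  have hP : PNPWave0.P Bool = Classes.P := P_bool_eq_holds
  have hNP : PNPWave0.NP Bool = Nondeterministic.NP := NP_bool_eq_holds
  show Literature.PNP.PNeNP ↔ _
  unfold Literature.PNP.PNeNP
  rw [hP, hNP, Set.not_subset]

/-- **Sub₂ of the canonical split**: derandomisation of `NP` under the collapse hypothesis. Open;
strictly weaker than X (X makes it vacuous) and not known to follow from anything short of
`BPP = P`-type derandomisation. -/
def DerandUnderCollapse : Prop :=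
  Nondeterministic.NP ⊆ BPP → Nondeterministic.NP ⊆ Classes.P

/-- Sub₁ ∧ Sub₂ ⟹ X. [folklore] -/
theorem crux_of_summit_and_derand (h₁ : _root_.PneNP) (h₂ : DerandUnderCollapse) :
    NoFBPPApproxAboveUniqueness :=
  noFBPPApproxAboveUniqueness_of_not_NP_subset_BPP fun hNP =>
    (pneNP_iff_not_NP_subset_P.1 h₁) (h₂ hNP)

/-- X ⟹ Sub₁ ∧ Sub₂. [folklore] -/
theorem summit_and_derand_of_crux (hX : NoFBPPApproxAboveUniqueness) :
    _root_.PneNP ∧ DerandUnderCollapse :=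
  ⟨pneNP_of_noFBPPApproxAboveUniqueness hX,
    fun hNP => absurd hNP (noFBPPApproxAboveUniqueness_iff_not_NP_subset_BPP.1 hX)⟩

/-- **The exact decomposition of the crux: X ⟺ PneNP ∧ (NP ⊆ BPP → NP ⊆ P).** Fact-free. The piece
that "remains the whole crux" is the SUMMIT ITSELF; what X adds over the summit is only Sub₂.
[folklore] -/
theorem crux_iff_summit_and_derand :
    NoFBPPApproxAboveUniqueness ↔ _root_.PneNP ∧ DerandUnderCollapse :=
  ⟨summit_and_derand_of_crux, fun h => crux_of_summit_and_derand h.1 h.2⟩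

/-- **Every split of X is a split of the summit** (because `X → PneNP` is a theorem): whatever
conjunction of sub-cruxes implies X implies `P ≠ NP`. [folklore] -/
theorem summit_of_any_split {Subs : Prop} (h : Subs → NoFBPPApproxAboveUniqueness) : Subs → _root_.PneNP :=
  fun hs => pneNP_of_noFBPPApproxAboveUniqueness (h hs)

/-- Sub₂ re-read: under the textbook collapse `NP ⊆ P → PH ⊆ P` (hypothesis `hcollapse`, Arora–Barak
Thm 5.4; kept explicit here rather than searched for in the tree) and Sipser–Gács–Lautemann
`BPP ⊆ Σ₂ᵖ` (proved: `BPP_subset_SigmaP_two`), Sub₂ says "if `NP ⊆ BPP` then `BPP = P`".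
[cite: AroraBarakCC2009, Thm. 5.4 and Thm. 7.15] -/
theorem derand_iff_of_collapse
    (hcollapse : Nondeterministic.NP ⊆ Classes.P → PH ⊆ Classes.P) :
    DerandUnderCollapse ↔ (Nondeterministic.NP ⊆ BPP → BPP ⊆ Classes.P) := by
  constructor
  · intro h hNP
    exact (BPP_subset_SigmaP_two.trans (SigmaP_subset_PH 2)).trans (hcollapse (h hNP))
  · intro h hNP
    exact hNP.trans (h hNP)

/-! ## §S Strengthen: typed S⁺ and their arrows to X -/

/-- **S⁺₁ (GŠV16's universal form)**: no FPRAS at ANY admissible `(Δ, p/q)`. -/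
def UniversalNoFPRAS : Prop :=
  ∀ Δ p q : ℕ, 3 ≤ Δ → 0 < q → hardCoreThreshold Δ < (p : ℝ) / q → ¬ HasFPRAS (hardcoreCount Δ p q)

/-- S⁺₁ ⟹ X (instantiate at `(3, 5, 1)`, `5 > λ_c(3) = 4`; padding removed by the Negative lane's
`not_crux_iff`). The converse holds modulo GŠV16 Thm 1 (`noFBPPApproxAboveUniqueness_iff_forall_not_hasFPRAS`).
[cite: GalanisStefankovicVigoda2016, Thm 1] -/
theorem crux_of_universalNoFPRAS (h : UniversalNoFPRAS) : NoFBPPApproxAboveUniqueness := by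
  by_contra hX
  have h35 : hardCoreThreshold 3 < ((5 : ℕ) : ℝ) / ((1 : ℕ) : ℝ) := by
    rw [hardCoreThreshold_three]; norm_num
  exact h 3 5 1 le_rfl one_pos h35 (Negative.not_crux_iff.1 hX 3 5 1 le_rfl one_pos h35)

/-- **S⁺₂ = route item #4 `PseudorandomTwinsAbove`** (samplable, computationally indistinguishable,
count-separated ensembles) ⟹ X: the landed glue (stmt-PneNP-2723). OWF-strength. [cite: Goldreich2001, §2.7.3 and §1.5.3] -/
theorem crux_of_pseudorandomTwinsAbove (h : PseudorandomTwinsAbove) : NoFBPPApproxAboveUniqueness :=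
  pseudorandomTwinsImplyTarget_proof h

/-- **S⁺₃ (non-uniform form) = the registered conjecture leaf `NP ⊄ P/poly`** ⟹ X (Adleman). The
non-uniform crux "no polynomial-size circuit family approximates `Z` above `λ_c`" sits between them.
[cite: AroraBarakCC2009, Thm. 7.14] -/
theorem crux_of_NPNotSubsetPPoly (h : Summit.PneNP.PneNP.NPNotSubsetPPoly) : NoFBPPApproxAboveUniqueness :=
  noFBPPApproxAboveUniqueness_of_NPNotSubsetPPoly h

/-- **S⁺₄ (cryptographic forms)**: `OWFExist ⟹ X`, `PRGExist ⟹ X`. [cite: Goldreich2001, §2.7.3 and §1.5.3] -/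
theorem crux_of_OWFExist_or_PRGExist
    (h : Literature.Computability.Cryptography.OWFExist ∨ Literature.Computability.Cryptography.PRGExist) :
    NoFBPPApproxAboveUniqueness :=
  h.elim noFBPPApproxAboveUniqueness_of_OWFExist noFBPPApproxAboveUniqueness_of_PRGExist

/-! ## §T Transfer: the solved sibling of this step and where the transfer breaks -/

/-- **The sibling, inside the route**: the DEPTH rung (crux #2) — "no `C^{n^θ}`-definable factor-2
approximation of `Z` above `λ_c`", i.e. Duplicator beats DEPTH — proved modulo Sly's gadget theorem
(named fact `slyGadgetReduction`, Sly 2010 Thm 2.1). [cite: Sly2010, Thm 2.1] -/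
theorem sibling_depth_rung (h : slyGadgetReduction) : PolyDepthTwinsAbove :=
  Summit.PneNP.PneNP.Cruxes.PolyDepthTwinsAbove.ParityWiredPorts.PolyDepthTwinsAbove_of_slyGadgetReduction h

/-- **Where depth → time breaks, kernel-checked instance**: CFI twins over a connected base are
`C^k`-equivalent for every `k ≤ tw(base)` (Chen–Flum–Liu 2025 / CFI 1992, PROVED in the tree) and yet
separated by a POLYNOMIAL-TIME algorithm (Chen–Flum–Liu 2025 Thm 8.1, PROVED in the tree as a `CodeFP`
program — a parity/Gaussian-elimination separator). So "indistinguishable to every depth-`n^θ` counting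
logic" does not give "indistinguishable to `FP`": the twins of the depth rung are built from exactly the
linear-algebraic (Tseitin/CFI/3XOR) structure that polynomial time decodes.
[cite: ChenFlumLiu2025, Thm. 8.1] [cite: CaiFurerImmerman1992, §6] -/
theorem transfer_break_depth_to_time :
    Literature.ModelTheory.FiniteModelTheory.ChenFlumLiu2025_ckEquiv_of_le_treewidth ∧
    Literature.ModelTheory.FiniteModelTheory.ChenFlumLiu2025_ptime_separation :=
  ⟨Literature.ModelTheory.FiniteModelTheory.ChenFlumLiu2025_ckEquiv_of_le_treewidth_holds,
    Literature.ModelTheory.FiniteModelTheory.ChenFlumLiu2025_ptime_separation_holds⟩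

/-- **The other solved restricted models and their catalogued transfer no-gos** (named barrier facts of
`Literature/Barriers/PneNP`, hypotheses explicit): monotone circuits (Razborov/Alon–Boppana) — no
polynomial monotone → general transfer (Tardos); low-degree / `k`-wise-independence indistinguishability
— no transfer to polynomial-time tests without symmetry (Holmgren–Wein, a linear-code + DECODING
counterexample: the same linear-algebra break as `transfer_break_depth_to_time`; catalogued as
`Literature.Barriers.PneNP.LowDegreeCounterexamples.not_lowDegreeTransfer`, cited by name only — that module is
not imported here because the gate's farm reported it incoherent at publication time); `AC⁰`/natural
properties — no natural proof against `P/poly` under hard PRGs (Razborov–Rudich). [cite: Tardos1988, p. 141]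
[cite: HolmgrenWein2021, Thm. 2 (PDF p. 6)] [cite: RazborovRudich1997, Thm. 4.1] -/
theorem transfer_nogos
    (hM : Literature.Barriers.PneNP.MonotoneGap)
    (hN : Literature.Barriers.PneNP.NaturalProofs) (hG : Literature.Barriers.PneNP.HardPRGExist) :
    (∀ p : ℕ, ¬ Literature.Barriers.PneNP.MonotoneTransfer fun v t => (v + t) ^ p) ∧
    (∀ L : Language Bool, ¬ ∃ Q : CombinatorialProperty,
      Literature.Barriers.PneNP.IsNaturalProof Q ∧ ∃ᶠ n in Filter.atTop, L.sliceFn n ∈ Q n) :=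
  ⟨fun p => hM.not_monotoneTransfer_pow p, fun L => hN.no_naturalProof_for hG L⟩

/-- The relativised crux `X^O` (`FP ↦ FP^O`, everything else verbatim; Disproof §6 / Negative lane). -/
def RelCrux (O : Oracle) : Prop :=
  ∃ Δ p q : ℕ, 3 ≤ Δ ∧ 0 < q ∧ hardCoreThreshold Δ < (p : ℝ) / q ∧
    ¬ ∃ F ∈ FPRel O, ∃ c r : Polynomial ℕ, ∀ (x : List Bool) (kη kδ : ℕ), 0 < kη → 0 < kδ →
      uniformProb (c.eval (x.length + r.eval x.length + kη + kδ))
        {u | ¬ IsApproxCount kη (hardcoreCount Δ p q x) (countEstimate F x (r.eval x.length) kη kδ u)} ≤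
          1 / (kδ : ℝ)

/-- **And at the top (time itself): the crux does not relativise** — UNCONDITIONALLY now, since the
route support `HardcoreCountSharpP` is proved (`hardcoreCountSharpP_proof`): Negative lane
`not_relativizes_relCrux` at the proved Baker–Gill–Solovay oracle. [cite: BakerGillSolovay1975, main theorems (P^A = NP^A)] -/
theorem no_relativising_proof : ¬ Literature.Barriers.PneNP.Relativizes RelCrux :=
  Negative.not_relativizes_relCrux hardcoreCountSharpP_proof

/-! ## §N Negation: the counterexample is exactly `NP ⊆ BPP` -/

/-- **A counterexample to X is a uniform family of FPRASes above `λ_c` at every `Δ ≥ 3`, equivalently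
`NP ⊆ BPP`.** (Negative lane `not_crux_iff` + calibration.) [folklore] -/
theorem counterexample_iff :
    (¬ NoFBPPApproxAboveUniqueness ↔
      ∀ Δ p q : ℕ, 3 ≤ Δ → 0 < q → hardCoreThreshold Δ < (p : ℝ) / q → HasFPRAS (hardcoreCount Δ p q)) ∧
    (¬ NoFBPPApproxAboveUniqueness ↔ Nondeterministic.NP ⊆ BPP) :=
  ⟨Negative.not_crux_iff, by rw [noFBPPApproxAboveUniqueness_iff_not_NP_subset_BPP, not_not]⟩

/-- **Restricted-instance obstruction, typed.** "No `FP` approximator (padded FBPP format of X) is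
correct on the instance family `𝒢`" at the corner `(Δ, p, q)`. For `𝒢 = univ` at an admissible corner
this is the inner body of X; for `𝒢` = the Sly/GŠV gadget family it is STILL `NP ⊄ BPP`-hard (the
family encodes all of MAX-CUT), and for the structured families where algorithms exist (bipartite
expanders at large `λ`, subcritical `λ < λ_c`, max degree ≤ 2) it is false — see the prose census §N. -/
def NoFPApproxOn (Δ p q : ℕ) (𝒢 : Set (List Bool)) : Prop :=
  ¬ ∃ F ∈ FP, ∃ c r : Polynomial ℕ, ∀ x ∈ 𝒢, ∀ (kη kδ : ℕ), 0 < kη → 0 < kδ →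
    uniformProb (c.eval (x.length + r.eval x.length + kη + kδ))
      {u | ¬ IsApproxCount kη (hardcoreCount Δ p q x) (countEstimate F x (r.eval x.length) kη kδ u)} ≤
        1 / (kδ : ℝ)

/-- Monotonicity of the obstruction in the family: shrinking `𝒢` weakens it. [folklore] -/
theorem NoFPApproxOn.anti {Δ p q : ℕ} {𝒢 𝒢' : Set (List Bool)} (h𝒢 : 𝒢 ⊆ 𝒢') (h : NoFPApproxOn Δ p q 𝒢) :
    NoFPApproxOn Δ p q 𝒢' :=
  fun ⟨F, hF, c, r, hP⟩ => h ⟨F, hF, c, r, fun x hx => hP x (h𝒢 hx)⟩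

/-- At `𝒢 = univ` the obstruction at an admissible corner IS the crux (so every instance-restricted
obstruction lemma that still covers an NP-hard sub-family is X again, and every one that does not is
either false or does not feed X). [folklore] -/
theorem crux_of_noFPApproxOn_univ {Δ p q : ℕ} (hΔ : 3 ≤ Δ) (hq : 0 < q)
    (hlam : hardCoreThreshold Δ < (p : ℝ) / q) (h : NoFPApproxOn Δ p q Set.univ) :
    NoFBPPApproxAboveUniqueness := by
  rw [Negative.crux_iff_inline]
  exact ⟨Δ, p, q, hΔ, hq, hlam, fun ⟨F, hF, c, r, hP⟩ => h ⟨F, hF, c, r, fun x _ => hP x⟩⟩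

end Summit.PneNP.PneNP.Cruxes.NoFBPPApproxAboveUniqueness.StrategyCensus
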